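import Literature.AlgebraicGeometry.HodgeTheory.VertexBlowupHyperplaneSection
import Literature.AlgebraicGeometry.Resolution.PullbackIrreducibleOfOpenFibres
import Literature.AlgebraicGeometry.Motives.PullbackOver
import Literature.AlgebraicGeometry.Motives.GoodReductionSpecialFibreProofs
import Literature.AlgebraicGeometry.Motives.GeometricallyIntegralAlgClosed
import HarnessLib

/-!
# The blown-up cone over a smooth projective subvariety of `ℙ^d_ℂ` as a base change of the vertex blow-up

Family `hodge`, layer `Literature/AlgebraicGeometry/HodgeTheory`. PROOF FILE (theorems only; no
definition, no named fact). Sequel of `HodgeTheory/VertexBlowupHyperplaneSection`: let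
`T = Bl_p ℙ^{d+1}_ℂ —q→ ℙ^d` be the blow-up of projective space in the vertex `p = (0 : … : 0 : 1)` with
its smooth projection and hyperplane section `s` (`exists_vertexBlowup_hyperplaneSection`). For a
smooth projective `S` with a closed immersion `ι : S ↪ ℙ^d`, the fibre product

  `E = T ×_{ℙ^d} S —π→ S`, `σ = (s ∘ ι, 𝟙) : S → E`, `φ₀ = pr₁ ≫ b : E → ℙ^{d+1}`

is the projective cone `C(S) ⊂ ℙ^{d+1}` over `S` with vertex `p`, blown up at the vertex
(`= ℙ_S(𝒪 ⊕ 𝒪(1))`), with `σ(S)` the base of the cone and `φ₀` the blow-down. This is the host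
of the cones of Aoki's theorem (N. Aoki, J. Math. Soc. Japan 39 (1987), Thm. 1-4 (i): "the cone over
`W` with vertex a point of `X⁰ₘ`") in the scheme language of the tree (`Motives.pullbackOver`,
`Motives.IsSmoothProjective`):

* `insertZero_last_comp_castSucc_of_apply_last_eq_zero` — index bookkeeping;
* `exists_coneHost` — **`E` is a smooth projective `(n+1)`-fold, `π` is flat, `σ` is a
  closed-immersion section, `σ ≫ φ₀ = ι ≫ (y ↦ (y : 0))`, the trichotomy of the homogeneous
  coordinates of `φ₀(e)` for complex points `e` (vertex / over a point of `S`; last coordinate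
  non-zero off `σ`), and `φ₀` is onto on local rings along `σ(S)`.**

Everything is proved from the two predecessors and Mathlib's base-change instances; no definitions.

## References

* [Aoki1987] N. Aoki, Some new algebraic cycles on Fermat varieties, J. Math. Soc. Japan 39 (1987),
  proof of Thm. 1-4, p. 388.
* [EisenbudHarris2016] D. Eisenbud, J. Harris, 3264 and All That, CUP 2016, §9.3.2, Prop. 9.11.
* [Hartshorne1977] R. Hartshorne, Algebraic Geometry, GTM 52, II Thm. 8.24, III.10 (base change of
  smooth morphisms).
* [DeJong1996] A. J. de Jong, Smoothness, semi-stability and alterations, Publ. Math. IHÉS 83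
  (1996), proof of Lemma 4.11, p. 68.
* [GortzWedhorn2020] U. Görtz, T. Wedhorn, Algebraic Geometry I, 2nd ed. 2020, Prop. 3.24, (4.10).
-/

noncomputable section

open CategoryTheory CategoryTheory.Limits AlgebraicGeometry
open Literature.AlgebraicGeometry.Motives Literature.AlgebraicGeometry.Resolution

namespace Literature.AlgebraicGeometry.HodgeTheory

section HodgeTheory

variable (d : ℕ)

/-! ### Index bookkeeping -/

/-- If the last coordinate of `u` vanishes, re-inserting `0` after dropping it gives back `u`.
[folklore] -/
private theorem insertZero_last_comp_castSucc_of_apply_last_eq_zero (u : Fin (d + 1 + 1) → ℂ)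
    (hu : u (Fin.last (d + 1)) = 0) :
    ProjectiveSpace.insertZero (Fin.last (d + 1)) (u ∘ Fin.castSucc) = u := by
  funext j
  induction j using Fin.lastCases with
  | last => rw [ProjectiveSpace.insertZero_self, hu]
  | cast i => rw [← Fin.succAbove_last, ProjectiveSpace.insertZero_succAbove, Fin.succAbove_last,
      Function.comp_apply]

variable {d}

/-! ### The cone host -/

/-- **The blown-up projective cone over a smooth projective subvariety `S ⊂ ℙ^d_ℂ`, as the base change
`E = T ×_{ℙ^d} S` of the vertex blow-up `T = Bl_p ℙ^{d+1} → ℙ^d`.** For `S` smooth projective of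
dimension `n` with a closed immersion `ι : S ↪ ℙ^d`, there are a smooth projective `(n+1)`-fold `E`,
a flat `π : E → S` (base change of the smooth projection `q`), a closed-immersion section `σ` of `π`
(induced by the hyperplane section `s` of `q`), and `φ₀ : E → ℙ^{d+1}` (`= pr₁ ≫ b`, the blow-down
onto the cone `C(S) = pr_p⁻¹(S) ∪ {p}`) such that: (base) `σ ≫ φ₀ = ι ≫ (y ↦ (y : 0))`; on complex
points, `φ₀(e) = [u]` where `(u₀, …, u_d)` is either `0` (the vertex) or a system of homogeneous
coordinates of `ι(π(e)) ∈ S` (so `φ₀(E) ⊆ C(S)`), and `u_{d+1} ≠ 0` UNLESS `e` lies on the section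
`σ` (the cone meets the hyperplane `x_{d+1} = 0` exactly along its base `S`, and `b` is one-to-one
off the vertex); and `φ₀` is onto on local rings at the points of `σ(S)` (`pr₁` is a closed immersion,
`b` a local isomorphism off the exceptional divisor) — so `φ₀_* 1 ≠ 0` downstream. `E` is smooth
projective: `q` is smooth of relative dimension `1` and `S` is smooth (base change and composition),
`E ↪ T` is a closed immersion into a projective variety, and `E` is irreducible
(`irreducibleSpace_pullback_of_isOpenMap_fibers`: `q` is open with irreducible fibres) and reduced.
Classically `E = ℙ_S(𝒪 ⊕ 𝒪(1))`, the blow-up of the cone `C(S)` at its vertex (Aoki 1987, proof of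
Thm. 1-4; Eisenbud–Harris §9.3.2).
[cite: EisenbudHarris2016, §9.3.2 and Prop. 9.11] [cite: Hartshorne1977, II Thm. 8.24]
[cite: DeJong1996, Lemma 4.11 (proof), p. 68] -/
theorem exists_coneHost {n : ℕ} {S : SchemeOver ℂ} (hS : IsSmoothProjective n S)
    (ι : S ⟶ projectiveSpace d ℂ) [hι : IsClosedImmersion ι.left] :
    ∃ (E : SchemeOver ℂ) (_ : IsSmoothProjective (n + 1) E) (π : E ⟶ S) (_ : Flat π.left)
      (σ : S ⟶ E) (_ : σ ≫ π = 𝟙 S) (_ : IsClosedImmersion σ.left)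
      (φ₀ : E ⟶ projectiveSpace (d + 1) ℂ),
      σ ≫ φ₀ = ι ≫ ProjectiveSpace.skipMap (k := ℂ) (Fin.last (d + 1)) ∧
      (∀ e : ComplexPoints E, ∃ (u : Fin (d + 1 + 1) → ℂ) (hu : u ≠ 0),
        AlgPoints.map φ₀ e = ProjectiveSpace.pointOfVec ℂ u hu ∧
        ((u ∘ Fin.castSucc : Fin (d + 1) → ℂ) = 0 ∨
          ∃ hu' : (u ∘ Fin.castSucc : Fin (d + 1) → ℂ) ≠ 0,
            AlgPoints.map ι (AlgPoints.map π e) = ProjectiveSpace.pointOfVec ℂ (u ∘ Fin.castSucc) hu') ∧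
        (e ∉ Set.range (AlgPoints.map (L := ℂ) σ) → u (Fin.last (d + 1)) ≠ 0)) ∧
      (∀ R : ComplexPoints S, Function.Surjective (φ₀.left.stalkMap (AlgPoints.map σ R).pt)) := by
  obtain ⟨T, b, q, s, hT, hq1, hfib, hsq, hsb, hstalk, hinj, hqb⟩ :=
    exists_vertexBlowup_hyperplaneSection d
  haveI : LocallyOfFiniteType S.hom := locallyOfFiniteType_of_isSmoothProjective hS
  haveI : IrreducibleSpace S.left := irreducibleSpace_of_isSmoothProjective' hS
  haveI : LocallyOfFiniteType T.hom := locallyOfFiniteType_of_isSmoothProjective hT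
  haveI : IsProper T.hom := IsSmoothProjective.isProper_holds hT
  haveI := hq1
  haveI : Smooth q.left := SmoothOfRelativeDimension.smooth 1 _
  -- the host and its structure maps
  let E : SchemeOver ℂ := pullbackOver q ι
  let f : E ⟶ T := pullbackOver.fst q ι
  let π : E ⟶ S := pullbackOver.snd q ι
  have hw : (ι ≫ s) ≫ q = 𝟙 S ≫ ι := by rw [Category.assoc, hsq, Category.comp_id, Category.id_comp]
  let σ : S ⟶ E := pullbackOver.lift (ι ≫ s) (𝟙 S) hw
  have hσf : σ ≫ f = ι ≫ s := pullbackOver.lift_fst _ _ hw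
  have hσπ : σ ≫ π = 𝟙 S := pullbackOver.lift_snd _ _ hw
  let φ₀ : E ⟶ projectiveSpace (d + 1) ℂ := f ≫ b
  -- smooth of relative dimension `n + 1`
  have hsm : SmoothOfRelativeDimension (n + 1) E.hom := by
    haveI := smoothOfRelativeDimension_isStableUnderBaseChange (n := 1)
    haveI : SmoothOfRelativeDimension 1 (pullback.snd q.left ι.left) :=
      MorphismProperty.pullback_snd _ _ hq1
    haveI := hS.smoothOfRelativeDimension
    have h2 : SmoothOfRelativeDimension (1 + n) (pullback.snd q.left ι.left ≫ S.hom) := inferInstance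
    have heq : pullback.snd q.left ι.left ≫ S.hom = E.hom := by
      change _ = pullback.fst q.left ι.left ≫ T.hom
      rw [← Over.w ι, ← Over.w q, pullback.condition_assoc]
    rw [heq, add_comm] at h2
    exact h2
  -- projective
  have hproj : IsProjectiveOver E := by
    obtain ⟨N, j, hj⟩ := hT.isProjectiveOver
    haveI := hj
    refine ⟨N, f ≫ j, ?_⟩
    rw [Over.comp_left]
    haveI : IsClosedImmersion f.left := inferInstanceAs (IsClosedImmersion (pullback.fst q.left ι.left))
    infer_instance
  -- irreducible, reduced, geometrically irreducible
  haveI : IrreducibleSpace E.left :=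
    irreducibleSpace_pullback_of_isOpenMap_fibers q.left ι.left q.left.isOpenMap hfib
  haveI : IsReduced E.left := isReduced_of_smoothOfRelativeDimension E.hom (n + 1)
  haveI : IsIntegral E.left := isIntegral_of_irreducibleSpace_of_isReduced _
  haveI := geometricallyIntegral_of_isAlgClosed E.hom
  have hgi : GeometricallyIrreducible E.hom := inferInstance
  have hE : IsSmoothProjective (n + 1) E := ⟨hsm, hproj, hgi⟩
  -- `π` flat; `σ` a closed immersion
  have hflat : Flat π.left := inferInstanceAs (Flat (pullback.snd q.left ι.left))
  haveI : IsSeparated q.left := by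
    have : IsSeparated (q.left ≫ (projectiveSpace d ℂ).hom) := by rw [Over.w q]; infer_instance
    exact IsSeparated.of_comp q.left (projectiveSpace d ℂ).hom
  haveI : IsSeparated π.left := inferInstanceAs (IsSeparated (pullback.snd q.left ι.left))
  have hσcl : IsClosedImmersion σ.left := by
    haveI : IsClosedImmersion (σ.left ≫ π.left) := by
      rw [← Over.comp_left, hσπ]
      exact inferInstanceAs (IsClosedImmersion (𝟙 S.left))
    exact IsClosedImmersion.of_comp σ.left π.left
  refine ⟨E, hE, π, hflat, σ, hσπ, hσcl, φ₀, ?_, ?_, ?_⟩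
  · -- (base)
    change σ ≫ f ≫ b = _
    rw [← Category.assoc, hσf, Category.assoc, hsb]
  · -- points
    intro e
    obtain ⟨u, hu, hbu⟩ := ProjectiveSpace.exists_eq_pointOfVec (AlgPoints.map b (AlgPoints.map f e))
    have hφe : AlgPoints.map φ₀ e = ProjectiveSpace.pointOfVec ℂ u hu := by
      rw [← hbu, AlgPoints.map_comp_apply]
    have hcond : AlgPoints.map q (AlgPoints.map f e) = AlgPoints.map ι (AlgPoints.map π e) := by
      rw [← AlgPoints.map_comp_apply, ← AlgPoints.map_comp_apply, pullbackOver.condition]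
    refine ⟨u, hu, hφe, ?_, ?_⟩
    · by_cases hz : (u ∘ Fin.castSucc : Fin (d + 1) → ℂ) = 0
      · exact Or.inl hz
      · exact Or.inr ⟨hz, by rw [← hcond, hqb _ u hu hz hbu]⟩
    · intro he hlast
      apply he
      have hz : (u ∘ Fin.castSucc : Fin (d + 1) → ℂ) ≠ 0 := by
        intro hz
        apply hu
        funext j
        induction j using Fin.lastCases with
        | last => exact hlast
        | cast i => exact congrFun hz i
      -- the point `s(q(f e))` of the hyperplane section has the same image under `b`
      have hq' := hqb _ u hu hz hbu
      have hb2 : AlgPoints.map b (AlgPoints.map (ι ≫ s) (AlgPoints.map π e)) =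
          ProjectiveSpace.pointOfVec ℂ u hu := by
        rw [AlgPoints.map_comp_apply, ← hcond, ← AlgPoints.map_comp_apply, hsb, hq',
          AlgPoints.map_apply, ProjectiveSpace.pointOfVec_comp_skipMap]
        congr 1
        exact insertZero_last_comp_castSucc_of_apply_last_eq_zero d u hlast
        |> fun h => by simp_rw [h]
      have ht₂ : AlgPoints.map (ι ≫ s) (AlgPoints.map π e) = AlgPoints.map f e :=
        hinj _ _ u hu hz hb2 hbu
      have key : AlgPoints.map σ (AlgPoints.map π e) = e := by
        apply (pullbackOver.pointsEquiv q ι ℂ).injective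
        refine Subtype.ext (Prod.ext ?_ ?_)
        · change AlgPoints.map f (AlgPoints.map σ (AlgPoints.map π e)) = AlgPoints.map f e
          rw [← AlgPoints.map_comp_apply σ f, hσf, ht₂]
        · change AlgPoints.map π (AlgPoints.map σ (AlgPoints.map π e)) = AlgPoints.map π e
          rw [← AlgPoints.map_comp_apply σ π, hσπ, AlgPoints.map_id_apply]
      exact ⟨_, key⟩
  · -- stalks at the points of the section
    intro R
    haveI : IsClosedImmersion f.left :=
      inferInstanceAs (IsClosedImmersion (pullback.fst q.left ι.left))
    have hsurjf : Function.Surjective (f.left.stalkMap (AlgPoints.map σ R).pt) :=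
      f.left.stalkMap_surjective _
    obtain ⟨z, hz, hιR⟩ := ProjectiveSpace.exists_eq_pointOfVec (AlgPoints.map ι R)
    have hbt : AlgPoints.map b (AlgPoints.map f (AlgPoints.map σ R)) =
        ProjectiveSpace.pointOfVec ℂ (ProjectiveSpace.insertZero (Fin.last (d + 1)) z)
          (ProjectiveSpace.insertZero_ne_zero _ hz) := by
      rw [← AlgPoints.map_comp_apply σ f, hσf, AlgPoints.map_comp_apply, ← AlgPoints.map_comp_apply s b,
        hsb, hιR, AlgPoints.map_apply, ProjectiveSpace.pointOfVec_comp_skipMap]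
    have hiso : IsIso (b.left.stalkMap (AlgPoints.map f (AlgPoints.map σ R)).pt) :=
      hstalk _ _ _ (by rw [insertZero_last_comp_castSucc]; exact hz) hbt
    have hbij := ConcreteCategory.bijective_of_isIso (b.left.stalkMap (AlgPoints.map f (AlgPoints.map σ R)).pt)
    change Function.Surjective ((f ≫ b).left.stalkMap (AlgPoints.map σ R).pt)
    rw [Over.comp_left, Scheme.Hom.stalkMap_comp]
    intro y
    obtain ⟨x₁, rfl⟩ := hsurjf y
    obtain ⟨x₂, rfl⟩ := hbij.2 x₁
    exact ⟨x₂, rfl⟩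


end HodgeTheory

end Literature.AlgebraicGeometry.HodgeTheory

end
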